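import Literature.ModelTheory.Zilber.EACProofs
import Summits.Schanuel.Schanuel.Theorems.ZilberDefs
import HarnessLib

/-!
# Bridge between the two typed EAC ladders

The cell `pub-schanuel` produced two typed spines of the Exponential-Algebraic Closedness ladder
for `ℂ_exp`: `Literature.ModelTheory.Zilber.ECCell n d` (seat 1, `EAC.lean`, with the ladder
bookkeeping discharged in `Literature/ModelTheory/Zilber/EACProofs.lean`: `ecCell_self`,
`ecCell_zero_right`, `ecCell_one_left`, `isExpAlgClosed_complex_iff_open_regime`,
`forall_ecCell_three_iff`, …) and this route's `Summit.Schanuel.Schanuel.Theorems.EacOfProjDim n d`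
(`ZilberDefs.lean`, rungs proved summit-side in `ZilberEacRungZero/One/Top.lean`). They agree
definitionally (`eacOfProjDim_iff_ecCell`, `eacRung32_iff_ecCell`), so every statement about one
ladder transfers to the other; in particular (granted the cited fact Mantova–Masser 2024 Thm 1.1)
`IsExpAlgClosed ℂ` is equivalent to the open regime of `EacOfProjDim`
(`isExpAlgClosed_complex_iff_eacOfProjDim_openRegime`) and, inside `ℂ³ × (ℂˣ)³`, to the single
rung `EacRung32` (`forall_eacOfProjDim_three_iff_eacRung32`). No duplication of the
`Literature.ModelTheory.Zilber` theorems: they are imported and reused.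
HONEST FRAMING: bookkeeping; the open regime is untouched; nothing here bears on Schanuel's conjecture.
-/

noncomputable section

open Literature.NumberTheory.Transcendental Literature.ModelTheory.Zilber

set_option linter.dupNamespace false

namespace Summit.Schanuel.Schanuel.Theorems

/-- The two typed ladders of the cell agree definitionally: `EacOfProjDim n d` (this route's
`ZilberDefs.lean`) is `Literature.ModelTheory.Zilber.ECCell n d` (`addProjDim` unfolds to the same
`zariskiDim` of the additive projection). [folklore] -/
theorem eacOfProjDim_iff_ecCell (n d : ℕ) : EacOfProjDim n d ↔ ECCell n d := Iff.rfl

/-- The first open rung in both vocabularies: `EacRung32 ↔ ECCell 3 2`. [folklore] -/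
theorem eacRung32_iff_ecCell : EacRung32 ↔ ECCell 3 2 := Iff.rfl

/-- **EAC reduces to the open regime of the summit-side ladder** (granted Mantova–Masser 2024
Thm 1.1; transfer of `Literature.ModelTheory.Zilber.isExpAlgClosed_complex_iff_open_regime`):
`IsExpAlgClosed ℂ ↔ ∀ n ≥ 3, 2 ≤ d ≤ n - 1, EacOfProjDim n d`. [cite: MantovaMasser2023, §1 Further remarks] -/
theorem isExpAlgClosed_complex_iff_eacOfProjDim_openRegime (hMM : mantovaMasser2024_thm_1_1) :
    IsExpAlgClosed ℂ ↔ ∀ n d : ℕ, 3 ≤ n → 2 ≤ d → d + 1 ≤ n → EacOfProjDim n d :=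
  isExpAlgClosed_complex_iff_open_regime hMM

/-- **Inside `ℂ³ × (ℂˣ)³` everything reduces to `EacRung32`** (granted Mantova–Masser 2024 Thm 1.1;
transfer of `Literature.ModelTheory.Zilber.forall_ecCell_three_iff`).
[cite: MantovaMasser2023, §1 Further remarks] -/
theorem forall_eacOfProjDim_three_iff_eacRung32 (hMM : mantovaMasser2024_thm_1_1) :
    (∀ d : ℕ, EacOfProjDim 3 d) ↔ EacRung32 :=
  forall_ecCell_three_iff hMM

end Summit.Schanuel.Schanuel.Theorems
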